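import Literature.Geometry.Riemannian.HamiltonCurvatureODE
import Literature.Analysis.ODE.HalfSpaceFlow
import Literature.Analysis.Convex.InfDistConvex
import Mathlib.Analysis.InnerProductSpace.PiL2
import Mathlib.Analysis.Convex.Jensen
import Mathlib.Analysis.Normed.Module.Convex
import Mathlib.Topology.MetricSpace.HausdorffDistance
import Mathlib.Topology.MetricSpace.Sequences
import Mathlib.Analysis.Calculus.MeanValue
import Mathlib.Analysis.ODE.ExistUnique
import Mathlib.Analysis.Calculus.ContDiff.RCLike
import HarnessLib

/-!
# Tools for Hamilton's maximum principle for systems: real induction, distance to a convex set,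
the midpoint estimate, confined ODE solutions, and the Euclidean model of block triples
(topic `Geometry/Riemannian`)

Elementary analysis used in the proof of the named fact
`Literature.Geometry.Riemannian.hamilton_maximumPrinciple_curvatureODE` (`HamiltonCurvatureODE.lean`;
Hamilton 1986, §4, Thm. 4.3 and Chow–Lu 2004, Thm. 3: "if the solutions of the ODE in each fibre
remain in the closed convex set `Z(t)`, so do the solutions of the PDE"). The proof in the tree
follows Hamilton's §4 in the arrangement "distance to `Z(t)` is sub-Lipschitz in `t`", for which
this file supplies the set-free ingredients:

* `HamiltonMP.Icc_induction` — **real induction** on `[0, T]`: a property holding at `0`, open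
  to the right and closed under limits from the left holds on all of `[0, T]` (the form in which
  "`D⁺U ≤ L U`, `U(0) = 0` forces `U ≡ 0`" is used, Hamilton 1986, §3, Lemma 3.1 ff.).
* `HamiltonMP.infDist_convex_combo_le`, `convexOn_infDist`, `isClosed_sublevel_infDist`,
  `convex_sublevel_infDist`, `infDist_le_infDist_sublevel_add` — **the distance to a convex set is a
  convex function** and its sublevel sets (closed neighbourhoods of the set) are closed convex
  (Hamilton 1986, §4, p. 160: "the distance `s(M)` from `M` to `X` … is convex"). The generic
  convexity statement now lives in the shared leaf `Literature/Analysis/Convex/InfDistConvex.lean`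
  (`Literature.Analysis.Convex.convexOn_infDist`, librarian promotion 1141960, item wi-30406,
  2026-08-16: the copy of `Literature.Geometry.Lorentzian.CornerSmoothing.convexOn_infDist` hoisted
  out of the Lorentzian causality import chain), which this file imports:
  `HamiltonMP.convexOn_infDist` is kept as a deprecated alias of it and `infDist_convex_combo_le`
  is its two-point instance.
* `HamiltonMP.norm_midpoint_defect_le`, `infDist_add_smul_le_of_midpoint` — the **second-order
  midpoint estimate**: for a `C²` curve `m` with `m(±h)` in a closed convex set `K`,
  `dist (m(0) + (h²/2) m''(0), K) ≤ ω h²` where `ω` bounds `‖m'' − m''(0)‖` on `[−h, h]` — the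
  convexity substitute for Hamilton's tangent-cone Lemma 4.1 used by the tree's proof.
* `HamiltonMP.exists_solution_mem_closedBall` — the single-initial-point form of the tree's
  `Literature.Analysis.ODE.exists_flow_mem_closedBall` (`Analysis/ODE/HalfSpaceFlow.lean`: Mathlib's
  Picard–Lindelöf theorem with the confinement of the solutions to the ball on which the hypotheses
  are stated; Hamilton 1986, §4, p. 160: "we only need this in a neighbourhood of the compact
  range"), and the speed / first-order estimates `norm_sub_le_of_speed`, `norm_sub_sub_smul_le`.
* `HamiltonMP.toEuc`, `ofEuc`, `blocksEquiv` — the **Euclidean model** `EuclideanSpace ℝ (Fin 3 ×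
  Fin 3 × Fin 3)` of the space `HamiltonODE.Blocks` of block triples `(A, B, C)` (entry `(k,i,j)` =
  entry `(i,j)` of the `k`-th block), a continuous linear equivalence, with the transport of
  entrywise derivatives (`HamiltonODE.HasDerivAt`) to Fréchet derivatives and the smoothness of
  Hamilton's quadratic field read in the model (`contDiff_fieldEuc`).

Everything is proved; no definition of `Prop` type is introduced.

## References

* R. S. Hamilton, *Four-manifolds with positive curvature operator*, J. Differential Geom. 24
  (1986) 153–179, §3 (Lemma 3.1–3.5, Lipschitz calculus), §4 (Lemma 4.1, Thm. 4.2, Thm. 4.3,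
  pp. 160–163). [Hamilton1986]
* B. Chow, P. Lu, *The time-dependent maximum principle for systems of parabolic equations subject
  to an avoidance set*, Pacific J. Math. 214 (2004) 201–222, §2, Thm. 3. [ChowLu2004]
-/

noncomputable section

open Set Metric Filter Topology
open scoped NNReal

namespace Literature.Geometry.Riemannian

namespace HamiltonMP

/-! ### Real induction on a closed interval -/

/-- **Real induction on `[0, T]`.** If `P 0`, if from every `t ∈ [0, T)` with `P t` the property
propagates to a right neighbourhood, and if `P t` follows from `P` on `[0, t)` for `t ∈ (0, T]`,
then `P` holds on `[0, T]` (the continuity method behind "`f(0) ≤ 0` and `D⁺f ≤ 0` when `f ≥ 0`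
imply `f ≤ 0`", Hamilton 1986, §3, Lemma 3.1 ff.). [cite: Hamilton1986, §3, Lemma 3.1] -/
theorem Icc_induction {P : ℝ → Prop} {T : ℝ} (h0 : P 0)
    (hright : ∀ t ∈ Ico 0 T, P t → ∃ δ > 0, ∀ s ∈ Ioc t (t + δ), s ≤ T → P s)
    (hleft : ∀ t ∈ Ioc 0 T, (∀ s ∈ Ico 0 t, P s) → P t) : ∀ t ∈ Icc 0 T, P t := by
  by_contra hcon
  push Not at hcon
  set bad : Set ℝ := {t | t ∈ Icc 0 T ∧ ¬P t} with hbad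
  have hne : bad.Nonempty := by
    obtain ⟨t, ht, hPt⟩ := hcon
    exact ⟨t, ht, hPt⟩
  have hbdd : BddBelow bad := ⟨0, fun t ht ↦ ht.1.1⟩
  set t₀ := sInf bad with ht₀
  have ht₀0 : 0 ≤ t₀ := le_csInf hne fun t ht ↦ ht.1.1
  have ht₀T : t₀ ≤ T := by
    obtain ⟨t, ht⟩ := hne
    exact (csInf_le hbdd ht).trans ht.1.2
  -- `P` holds strictly before `t₀`
  have hbefore : ∀ s ∈ Ico 0 t₀, P s := by
    intro s hs
    by_contra hPs
    have hsT : s ≤ T := (hs.2.le.trans ht₀T)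
    have : t₀ ≤ s := csInf_le hbdd ⟨⟨hs.1, hsT⟩, hPs⟩
    exact absurd hs.2 (not_lt.2 this)
  -- hence at `t₀`
  have hP₀ : P t₀ := by
    rcases ht₀0.eq_or_lt with h | h
    · rw [← h]; exact h0
    · exact hleft t₀ ⟨h, ht₀T⟩ hbefore
  rcases ht₀T.eq_or_lt with hEq | hLt
  · -- `t₀ = T`: every bad point is `≥ T`, hence equal to `T`, but `P T`
    obtain ⟨t, ht⟩ := hne
    have h1 : t₀ ≤ t := csInf_le hbdd ht
    have h2 : t = T := le_antisymm ht.1.2 (hEq ▸ h1)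
    exact ht.2 (h2 ▸ hEq ▸ hP₀)
  · obtain ⟨δ, hδ, hδP⟩ := hright t₀ ⟨ht₀0, hLt⟩ hP₀
    have hlb : ∀ t ∈ bad, t₀ + δ ≤ t := by
      intro t ht
      rcases le_or_gt (t₀ + δ) t with hle | hlt
      · exact hle
      exfalso
      have h1 : t₀ ≤ t := csInf_le hbdd ht
      rcases h1.eq_or_lt with h | h
      · exact ht.2 (h ▸ hP₀)
      · exact ht.2 (hδP t ⟨h, hlt.le⟩ ht.1.2)
    have : t₀ + δ ≤ t₀ := le_csInf hne hlb
    linarith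

/-! ### Distance to a convex set

The convexity of `p ↦ infDist p C` for a nonempty convex `C` is the shared leaf lemma
`Literature.Analysis.Convex.convexOn_infDist` (`Literature/Analysis/Convex/InfDistConvex.lean`,
librarian promotion 1141960, item wi-30406, 2026-08-16); the former local copy
`HamiltonMP.convexOn_infDist` is a deprecated alias of it, and the lemmas of this section are its
instances. -/

section Convex

variable {F : Type*} [NormedAddCommGroup F] [NormedSpace ℝ F] {C : Set F}

/-- **Convexity of the distance to a convex set** along a segment: for `C` convex nonempty and
`a, b ≥ 0`, `a + b = 1`, `dist(a p + b q, C) ≤ a dist(p, C) + b dist(q, C)` (Hamilton 1986, §4,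
p. 160) — the two-point instance of `Literature.Analysis.Convex.convexOn_infDist`.
[cite: Hamilton1986, §4, p. 160] -/
theorem infDist_convex_combo_le (hC : Convex ℝ C) (hne : C.Nonempty) (p q : F) {a b : ℝ}
    (ha : 0 ≤ a) (hb : 0 ≤ b) (hab : a + b = 1) :
    infDist (a • p + b • q) C ≤ a * infDist p C + b * infDist q C := by
  simpa only [smul_eq_mul] using
    (Literature.Analysis.Convex.convexOn_infDist hC hne).2 (mem_univ p) (mem_univ q) ha hb hab

/-- **The distance to a nonempty convex set is a convex function** — **deprecated alias** of the
shared leaf lemma `Literature.Analysis.Convex.convexOn_infDist`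
(`Analysis/Convex/InfDistConvex.lean`), of which this was a local copy (Hamilton 1986, §4, p. 160:
"the distance `s(M)` from `M` to `X` … is convex"). [cite: Hamilton1986, §4, p. 160] -/
@[deprecated Literature.Analysis.Convex.convexOn_infDist (since := "2026-08-16")]
alias convexOn_infDist := Literature.Analysis.Convex.convexOn_infDist

/-- **Jensen for the distance to a convex set**: the distance of an average of finitely many
points is at most the average of their distances. [cite: Hamilton1986, §4, p. 160] -/
theorem infDist_centerMass_le {ι : Type*} (hC : Convex ℝ C) (hne : C.Nonempty) (s : Finset ι)
    (w : ι → ℝ) (hw : ∀ i ∈ s, 0 ≤ w i) (hw1 : 0 < ∑ i ∈ s, w i) (p : ι → F) :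
    infDist (s.centerMass w p) C ≤ s.centerMass w (fun i ↦ infDist (p i) C) :=
  (Literature.Analysis.Convex.convexOn_infDist hC hne).map_centerMass_le hw hw1
    fun _ _ ↦ mem_univ _

omit [NormedSpace ℝ F] in
/-- The closed `D`-neighbourhood `{p : dist(p, C) ≤ D}` of a set is closed. [folklore] -/
theorem isClosed_sublevel_infDist (C : Set F) (D : ℝ) : IsClosed {p : F | infDist p C ≤ D} :=
  isClosed_le (continuous_infDist_pt C) continuous_const

/-- The closed `D`-neighbourhood of a nonempty convex set is convex. [cite: Hamilton1986, §4, p. 160] -/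
theorem convex_sublevel_infDist (hC : Convex ℝ C) (hne : C.Nonempty) (D : ℝ) :
    Convex ℝ {p : F | infDist p C ≤ D} := by
  simpa only [sep_univ] using (Literature.Analysis.Convex.convexOn_infDist hC hne).convex_le D

omit [NormedSpace ℝ F] in
/-- `dist(p, C) ≤ dist(p, C_D) + D` for the closed `D`-neighbourhood `C_D` of `C` (when it is
nonempty). [folklore] -/
theorem infDist_le_infDist_sublevel_add {p : F} {D : ℝ}
    (hD : ({q : F | infDist q C ≤ D}).Nonempty) :
    infDist p C ≤ infDist p {q : F | infDist q C ≤ D} + D := by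
  have h : infDist p C - D ≤ infDist p {q : F | infDist q C ≤ D} := by
    refine (le_infDist hD).2 fun q hq ↦ ?_
    have := infDist_le_infDist_add_dist (x := p) (y := q) (s := C)
    have hq' : infDist q C ≤ D := hq
    linarith
  linarith

omit [NormedSpace ℝ F] in
/-- A point at distance `≤ D` lies in the closed `D`-neighbourhood; in particular the set itself
does (for `D ≥ 0`). [folklore] -/
theorem mem_sublevel_infDist_of_mem {p : F} {D : ℝ} (hp : p ∈ C) (hD : 0 ≤ D) :
    p ∈ {q : F | infDist q C ≤ D} := by
  change infDist p C ≤ D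
  rw [infDist_zero_of_mem hp]
  exact hD

end Convex

/-! ### The second-order midpoint estimate -/

section Midpoint

variable {F : Type*} [NormedAddCommGroup F] [NormedSpace ℝ F]

/-- **Midpoint defect of a `C²` curve.** If `m` has first and second derivatives `m'`, `m''` on
`[−h, h]` and `‖m''(s) − m''(0)‖ ≤ ω` there, then
`‖m(h) + m(−h) − 2 m(0) − h² m''(0)‖ ≤ 2 ω h²` (two applications of the mean value inequality to
`φ(s) = m(s) + m(−s) − 2m(0) − s² m''(0)`, whose first two derivatives vanish at `0`). [folklore] -/
theorem norm_midpoint_defect_le {m m' m'' : ℝ → F} {h ω : ℝ} (hh : 0 ≤ h)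
    (hm : ∀ s ∈ Icc (-h) h, HasDerivAt m (m' s) s)
    (hm' : ∀ s ∈ Icc (-h) h, HasDerivAt m' (m'' s) s)
    (hω : ∀ s ∈ Icc (-h) h, ‖m'' s - m'' 0‖ ≤ ω) :
    ‖m h + m (-h) - (2 : ℝ) • m 0 - h ^ 2 • m'' 0‖ ≤ 2 * ω * h ^ 2 := by
  have hω0 : 0 ≤ ω := le_trans (norm_nonneg _) (hω 0 ⟨by linarith, hh⟩)
  -- the auxiliary function `φ(s) = m(s) + m(−s) − 2m(0) − s² m''(0)` and its derivatives
  have hmem : ∀ s ∈ Icc (0 : ℝ) h, s ∈ Icc (-h) h ∧ -s ∈ Icc (-h) h := fun s hs ↦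
    ⟨⟨by linarith [hs.1], hs.2⟩, ⟨by linarith [hs.2], by linarith [hs.1]⟩⟩
  have hdφ : ∀ s ∈ Icc (0 : ℝ) h,
      HasDerivAt (fun x ↦ m x + m (-x) - (2 : ℝ) • m 0 - x ^ 2 • m'' 0)
        (m' s - m' (-s) - (2 * s) • m'' 0) s := by
    intro s hs
    obtain ⟨h1, h2⟩ := hmem s hs
    have hb : HasDerivAt (fun x ↦ m (-x)) (-(m' (-s))) s := by
      simpa [Function.comp_def] using (hm (-s) h2).scomp s (hasDerivAt_neg s)
    have hc : HasDerivAt (fun x : ℝ ↦ x ^ 2 • m'' 0) ((2 * s) • m'' 0) s := by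
      simpa using (hasDerivAt_pow 2 s).smul_const (m'' 0)
    refine ((((hm s h1).add hb).sub_const ((2 : ℝ) • m 0)).sub hc).congr_deriv ?_
    abel
  have hdφ' : ∀ s ∈ Icc (0 : ℝ) h,
      HasDerivAt (fun x ↦ m' x - m' (-x) - (2 * x) • m'' 0)
        (m'' s + m'' (-s) - (2 : ℝ) • m'' 0) s := by
    intro s hs
    obtain ⟨h1, h2⟩ := hmem s hs
    have hb : HasDerivAt (fun x ↦ m' (-x)) (-(m'' (-s))) s := by
      simpa [Function.comp_def] using (hm' (-s) h2).scomp s (hasDerivAt_neg s)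
    have hc : HasDerivAt (fun x : ℝ ↦ (2 * x) • m'' 0) ((2 : ℝ) • m'' 0) s := by
      simpa using ((hasDerivAt_id s).const_mul 2).smul_const (m'' 0)
    refine (((hm' s h1).sub hb).sub hc).congr_deriv ?_
    abel
  -- bound on `φ''`, then on `φ'`, then on `φ`
  have hbφ'' : ∀ s ∈ Ico (0 : ℝ) h, ‖m'' s + m'' (-s) - (2 : ℝ) • m'' 0‖ ≤ 2 * ω := by
    intro s hs
    obtain ⟨h1, h2⟩ := hmem s (Ico_subset_Icc_self hs)
    have : m'' s + m'' (-s) - (2 : ℝ) • m'' 0 = (m'' s - m'' 0) + (m'' (-s) - m'' 0) := by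
      simp only [two_smul]; abel
    rw [this]
    exact (norm_add_le _ _).trans (by linarith [hω s h1, hω (-s) h2])
  have hbφ' : ∀ s ∈ Ico (0 : ℝ) h, ‖m' s - m' (-s) - (2 * s) • m'' 0‖ ≤ 2 * ω * h := by
    intro s hs
    have key := norm_image_sub_le_of_norm_deriv_le_segment'
      (fun x hx ↦ (hdφ' x hx).hasDerivWithinAt) hbφ'' s (Ico_subset_Icc_self hs)
    simp only [neg_zero, sub_self, mul_zero, zero_smul, sub_zero] at key
    calc ‖m' s - m' (-s) - (2 * s) • m'' 0‖ ≤ 2 * ω * s := key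
      _ ≤ 2 * ω * h := by nlinarith [hs.2, hω0, hs.1]
  have key := norm_image_sub_le_of_norm_deriv_le_segment'
    (fun x hx ↦ (hdφ x hx).hasDerivWithinAt) hbφ' h ⟨hh, le_rfl⟩
  simp only [neg_zero, two_smul, ne_eq, OfNat.ofNat_ne_zero, not_false_eq_true, zero_pow,
    zero_smul, sub_zero, sub_self] at key
  calc ‖m h + m (-h) - (2 : ℝ) • m 0 - h ^ 2 • m'' 0‖
      = ‖m h + m (-h) - (m 0 + m 0) - h ^ 2 • m'' 0‖ := by rw [two_smul]
    _ ≤ 2 * ω * h * h := key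
    _ = 2 * ω * h ^ 2 := by ring

/-- **Second-order midpoint estimate against a convex set.** If in addition `m(h)` and `m(−h)`
lie in a convex set `K`, then `dist(m(0) + (h²/2) m''(0), K) ≤ ω h²`: the midpoint
`(m(h) + m(−h))/2` lies in `K` and is `ω h²`-close to `m(0) + (h²/2) m''(0)`. This is the form in
which the tree's proof of Hamilton's Thm. 4.3 extracts "the Laplacian points into the set" from
convexity (replacing the tangent-cone Lemma 4.1 of Hamilton 1986, §4). [cite: Hamilton1986, §4, Lemma 4.1] -/
theorem infDist_add_smul_le_of_midpoint {K : Set F} (hK : Convex ℝ K) {m m' m'' : ℝ → F}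
    {h ω : ℝ} (hh : 0 ≤ h) (hm : ∀ s ∈ Icc (-h) h, HasDerivAt m (m' s) s)
    (hm' : ∀ s ∈ Icc (-h) h, HasDerivAt m' (m'' s) s)
    (hω : ∀ s ∈ Icc (-h) h, ‖m'' s - m'' 0‖ ≤ ω) (hKh : m h ∈ K) (hKh' : m (-h) ∈ K) :
    infDist (m 0 + (h ^ 2 / 2) • m'' 0) K ≤ ω * h ^ 2 := by
  have hmid : (1 / 2 : ℝ) • m h + (1 / 2 : ℝ) • m (-h) ∈ K :=
    hK hKh hKh' (by norm_num) (by norm_num) (by norm_num)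
  refine (infDist_le_dist_of_mem hmid).trans ?_
  have hdef := norm_midpoint_defect_le hh hm hm' hω
  rw [dist_eq_norm]
  have : m 0 + (h ^ 2 / 2) • m'' 0 - ((1 / 2 : ℝ) • m h + (1 / 2 : ℝ) • m (-h)) =
      (-(1 / 2 : ℝ)) • (m h + m (-h) - (2 : ℝ) • m 0 - h ^ 2 • m'' 0) := by
    module
  rw [this, norm_smul, norm_neg, Real.norm_of_nonneg (by norm_num : (0 : ℝ) ≤ 1 / 2)]
  nlinarith [hdef, norm_nonneg (m h + m (-h) - (2 : ℝ) • m 0 - h ^ 2 • m'' 0)]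

end Midpoint

/-! ### Confined solutions of ODEs (Picard–Lindelöf) -/

section ODE

variable {E : Type*} [NormedAddCommGroup E] [NormedSpace ℝ E] [CompleteSpace E]
  {f : ℝ → E → E} {tmin tmax : ℝ} {t₀ : Icc tmin tmax} {x₀ x : E} {a r L K : ℝ≥0}

/-- **Picard–Lindelöf with confinement**, single initial point: under Mathlib's
`IsPicardLindelof f t₀ x₀ a r L K` on `[tmin, tmax]`, every `x` with `‖x − x₀‖ ≤ r` is the initial
value `α t₀ = x` of a solution on `[tmin, tmax]` staying in `closedBall x₀ a` — the tree's
`Literature.Analysis.ODE.exists_flow_mem_closedBall` (local flow with confinement) at one point.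
Hamilton 1986, §4, p. 160: the system "need only be defined in a neighbourhood of the compact
range". [cite: Hamilton1986, §4, p. 160] -/
theorem exists_solution_mem_closedBall (hf : IsPicardLindelof f t₀ x₀ a r L K)
    (hx : x ∈ closedBall x₀ r) :
    ∃ α : ℝ → E, α t₀ = x ∧
      (∀ t ∈ Icc tmin tmax, HasDerivWithinAt α (f t (α t)) (Icc tmin tmax) t) ∧
      ∀ t ∈ Icc tmin tmax, α t ∈ closedBall x₀ a := by
  obtain ⟨α, hα⟩ := Literature.Analysis.ODE.exists_flow_mem_closedBall hf
  obtain ⟨h0, hd, hb⟩ := hα x hx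
  exact ⟨α x, h0, hd, fun t _ ↦ hb t⟩

omit [CompleteSpace E] in
/-- **Bounded speed.** A solution of `α' = f(t, α)` on `[tmin, tmax]` confined to a set on which
`‖f‖ ≤ L` moves at speed at most `L`: `‖α s − α t‖ ≤ L (s − t)` for `tmin ≤ t ≤ s ≤ tmax`.
[cite: Hamilton1986, §3, Lemma 3.2] -/
theorem norm_sub_le_of_speed {α : ℝ → E} {B : Set E} {L' : ℝ}
    (hα : ∀ t ∈ Icc tmin tmax, HasDerivWithinAt α (f t (α t)) (Icc tmin tmax) t)
    (hmem : ∀ t ∈ Icc tmin tmax, α t ∈ B) (hL : ∀ t ∈ Icc tmin tmax, ∀ y ∈ B, ‖f t y‖ ≤ L')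
    {t s : ℝ} (ht : tmin ≤ t) (hts : t ≤ s) (hs : s ≤ tmax) :
    ‖α s - α t‖ ≤ L' * (s - t) := by
  have hsub : Icc t s ⊆ Icc tmin tmax := Icc_subset_Icc ht hs
  have key := norm_image_sub_le_of_norm_deriv_le_segment' (f := α) (f' := fun τ ↦ f τ (α τ))
    (fun τ hτ ↦ (hα τ (hsub hτ)).mono hsub)
    (fun τ hτ ↦ hL τ (hsub (Ico_subset_Icc_self hτ)) _ (hmem τ (hsub (Ico_subset_Icc_self hτ))))
    s (right_mem_Icc.2 hts)
  simpa using key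

omit [CompleteSpace E] in
/-- **First-order expansion with a modulus.** If `α' = f(t, α)` on `[tmin, tmax]` and
`‖f(τ, α τ) − v‖ ≤ η` for `τ ∈ [t, s]`, then `‖α s − α t − (s − t) • v‖ ≤ η (s − t)`. [folklore] -/
theorem norm_sub_sub_smul_le {α : ℝ → E} {v : E} {η : ℝ}
    (hα : ∀ t ∈ Icc tmin tmax, HasDerivWithinAt α (f t (α t)) (Icc tmin tmax) t)
    {t s : ℝ} (ht : tmin ≤ t) (hts : t ≤ s) (hs : s ≤ tmax)
    (hη : ∀ τ ∈ Icc t s, ‖f τ (α τ) - v‖ ≤ η) :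
    ‖α s - α t - (s - t) • v‖ ≤ η * (s - t) := by
  have hsub : Icc t s ⊆ Icc tmin tmax := Icc_subset_Icc ht hs
  set β : ℝ → E := fun τ ↦ α τ - τ • v with hβ
  have hdβ : ∀ τ ∈ Icc t s, HasDerivWithinAt β (f τ (α τ) - v) (Icc t s) τ := fun τ hτ ↦
    ((hα τ (hsub hτ)).mono hsub).sub (by simpa using (hasDerivWithinAt_id τ _).smul_const v)
  have key := norm_image_sub_le_of_norm_deriv_le_segment' hdβ
    (fun τ hτ ↦ hη τ (Ico_subset_Icc_self hτ)) s (right_mem_Icc.2 hts)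
  have : β s - β t = α s - α t - (s - t) • v := by simp only [hβ, sub_smul]; abel
  rw [this] at key
  exact key

end ODE

/-! ### The Euclidean model of the space of block triples -/

section Euclidean

open HamiltonODE

/-- The index set of the entries of a block triple: `(k, i, j)` is entry `(i, j)` of block `k`
(`k = 0, 1, 2` for `A, B, C`). [cite: Hamilton1986, §6, p. 165] -/
abbrev BIdx : Type := Fin 3 × Fin 3 × Fin 3

/-- The Euclidean model of `Blocks`: `ℝ^{27}` with its standard inner product (the Frobenius norm
`|A|² + |B|² + |C|²`). [cite: Hamilton1986, §4, p. 160] -/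
abbrev Euc : Type := EuclideanSpace ℝ BIdx

/-- The `k`-th block of a triple. [cite: Hamilton1986, §6, p. 165] -/
def blk (p : Blocks) : Fin 3 → Matrix (Fin 3) (Fin 3) ℝ := ![p.1, p.2.1, p.2.2]

/-- Block `0` is `A`. [folklore] -/
@[simp] theorem blk_zero (p : Blocks) : blk p 0 = p.1 := rfl

/-- Block `1` is `B`. [folklore] -/
@[simp] theorem blk_one (p : Blocks) : blk p 1 = p.2.1 := rfl

/-- Block `2` is `C`. [folklore] -/
@[simp] theorem blk_two (p : Blocks) : blk p 2 = p.2.2 := rfl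

/-- Block triples read in the Euclidean model (entry `(k,i,j)` ↦ entry `(i,j)` of block `k`), a
linear map. [cite: Hamilton1986, §4, p. 160] -/
def toEuc : Blocks →ₗ[ℝ] Euc where
  toFun p := (EuclideanSpace.equiv BIdx ℝ).symm fun q ↦ blk p q.1 q.2.1 q.2.2
  map_add' p p' := by
    rw [← map_add]; congr 1; funext q
    obtain ⟨k, i, j⟩ := q
    fin_cases k <;> simp [blk]
  map_smul' c p := by
    rw [← map_smul]; congr 1; funext q
    obtain ⟨k, i, j⟩ := q
    fin_cases k <;> simp [blk]

/-- The entries of `toEuc p`. [folklore] -/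
@[simp] theorem toEuc_apply (p : Blocks) (q : BIdx) : toEuc p q = blk p q.1 q.2.1 q.2.2 := by
  simp [toEuc]

/-- The inverse reading: a vector of `ℝ^{27}` as a block triple. [folklore] -/
def ofEuc : Euc →ₗ[ℝ] Blocks where
  toFun v := (Matrix.of fun i j ↦ v (0, i, j), Matrix.of fun i j ↦ v (1, i, j),
    Matrix.of fun i j ↦ v (2, i, j))
  map_add' v w := by ext i j <;> simp
  map_smul' c v := by ext i j <;> simp

/-- Entries of the `A`-block of `ofEuc v`. [folklore] -/
@[simp] theorem ofEuc_fst (v : Euc) (i j : Fin 3) : (ofEuc v).1 i j = v (0, i, j) := rfl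

/-- Entries of the `B`-block of `ofEuc v`. [folklore] -/
@[simp] theorem ofEuc_snd_fst (v : Euc) (i j : Fin 3) : (ofEuc v).2.1 i j = v (1, i, j) := rfl

/-- Entries of the `C`-block of `ofEuc v`. [folklore] -/
@[simp] theorem ofEuc_snd_snd (v : Euc) (i j : Fin 3) : (ofEuc v).2.2 i j = v (2, i, j) := rfl

/-- `ofEuc ∘ toEuc = id`. [folklore] -/
@[simp] theorem ofEuc_toEuc (p : Blocks) : ofEuc (toEuc p) = p := by
  obtain ⟨A, B, C⟩ := p
  ext i j <;> simp [blk]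

/-- `toEuc ∘ ofEuc = id`. [folklore] -/
@[simp] theorem toEuc_ofEuc (v : Euc) : toEuc (ofEuc v) = v := by
  ext q
  obtain ⟨k, i, j⟩ := q
  fin_cases k <;> simp [blk]

/-- `toEuc` is continuous (each entry is a coordinate projection). [folklore] -/
theorem continuous_toEuc : Continuous (toEuc : Blocks → Euc) := by
  have : Continuous fun p : Blocks ↦ fun q : BIdx ↦ blk p q.1 q.2.1 q.2.2 := by
    refine continuous_pi fun q ↦ ?_
    obtain ⟨k, i, j⟩ := q
    fin_cases k
    · exact (continuous_fst.matrix_elem i j)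
    · exact (continuous_snd.fst.matrix_elem i j)
    · exact (continuous_snd.snd.matrix_elem i j)
  exact (EuclideanSpace.equiv BIdx ℝ).symm.continuous.comp this

/-- `ofEuc` is continuous. [folklore] -/
theorem continuous_ofEuc : Continuous (ofEuc : Euc → Blocks) := by
  have hc : ∀ q : BIdx, Continuous fun v : Euc ↦ v q := fun q ↦
    (continuous_apply q).comp (EuclideanSpace.equiv BIdx ℝ).continuous
  refine (continuous_matrix fun i j ↦ hc (0, i, j)).prodMk
    ((continuous_matrix fun i j ↦ hc (1, i, j)).prodMk (continuous_matrix fun i j ↦ hc (2, i, j)))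

/-- **The Euclidean model of `Blocks` as a continuous linear equivalence.** [folklore] -/
def blocksEquiv : Blocks ≃L[ℝ] Euc where
  toLinearEquiv :=
    { toEuc with
      invFun := ofEuc
      left_inv := ofEuc_toEuc
      right_inv := toEuc_ofEuc }
  continuous_toFun := continuous_toEuc
  continuous_invFun := continuous_ofEuc

/-- `blocksEquiv` is `toEuc`. [folklore] -/
@[simp] theorem blocksEquiv_apply (p : Blocks) : blocksEquiv p = toEuc p := rfl

/-- The inverse of `blocksEquiv` is `ofEuc`. [folklore] -/
@[simp] theorem blocksEquiv_symm_apply (v : Euc) : blocksEquiv.symm v = ofEuc v := rfl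

/-- Every entry of a block triple is bounded by the Euclidean norm of its model. [folklore] -/
theorem abs_blk_le_norm (p : Blocks) (k i j : Fin 3) : |blk p k i j| ≤ ‖toEuc p‖ := by
  have h := EuclideanSpace.norm_eq (toEuc p)
  have hsq : (blk p k i j) ^ 2 ≤ ∑ q : BIdx, ‖toEuc p q‖ ^ 2 := by
    have := Finset.single_le_sum (f := fun q : BIdx ↦ ‖toEuc p q‖ ^ 2) (fun q _ ↦ sq_nonneg _)
      (Finset.mem_univ (k, i, j))
    simpa [Real.norm_eq_abs, sq_abs] using this
  rw [h]
  calc |blk p k i j| = Real.sqrt ((blk p k i j) ^ 2) := (Real.sqrt_sq_eq_abs _).symm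
    _ ≤ Real.sqrt (∑ q : BIdx, ‖toEuc p q‖ ^ 2) := Real.sqrt_le_sqrt hsq

/-- **Entrywise derivatives are Fréchet derivatives in the model**: a curve of block triples with
entrywise derivative `γ'` (`HamiltonODE.HasDerivAt`) read in `ℝ^{27}` has derivative `toEuc γ'`.
[folklore] -/
theorem hasDerivAt_toEuc {γ : ℝ → Blocks} {γ' : Blocks} {t : ℝ} (h : HamiltonODE.HasDerivAt γ γ' t) :
    _root_.HasDerivAt (fun s ↦ toEuc (γ s)) (toEuc γ') t := by
  have hpi : _root_.HasDerivAt (fun s ↦ fun q : BIdx ↦ blk (γ s) q.1 q.2.1 q.2.2)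
      (fun q : BIdx ↦ blk γ' q.1 q.2.1 q.2.2) t := by
    rw [hasDerivAt_pi]
    rintro ⟨k, i, j⟩
    fin_cases k
    · exact h.1 i j
    · exact h.2.1 i j
    · exact h.2.2 i j
  have key := ((EuclideanSpace.equiv BIdx ℝ).symm : (BIdx → ℝ) →L[ℝ] Euc).hasFDerivAt.comp_hasDerivAt
    t hpi
  exact key

/-- Conversely, a Fréchet derivative in the model gives the entrywise derivative of the block
triples. [folklore] -/
theorem hasDerivAt_ofEuc {β : ℝ → Euc} {β' : Euc} {t : ℝ} (h : _root_.HasDerivAt β β' t) :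
    HamiltonODE.HasDerivAt (fun s ↦ ofEuc (β s)) (ofEuc β') t := by
  have hpi : _root_.HasDerivAt (fun s ↦ (EuclideanSpace.equiv BIdx ℝ) (β s))
      ((EuclideanSpace.equiv BIdx ℝ) β') t :=
    ((EuclideanSpace.equiv BIdx ℝ) : Euc →L[ℝ] (BIdx → ℝ)).hasFDerivAt.comp_hasDerivAt t h
  rw [hasDerivAt_pi] at hpi
  refine ⟨fun i j ↦ ?_, fun i j ↦ ?_, fun i j ↦ ?_⟩
  · simpa using hpi (0, i, j)
  · simpa using hpi (1, i, j)
  · simpa using hpi (2, i, j)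

/-- Hamilton's quadratic field in the tree's frame convention (`B ↦ −B` conjugate of
`HamiltonODE.field`, i.e. `(A² + BᵗB + 2A^#, AB + BC − 2B^#, C² + ᵗBB + 2C^#)`), read in the
Euclidean model. [cite: Hamilton1986, §6, p. 166] -/
def fieldEuc (v : Euc) : Euc := toEuc (reflectB (field (reflectB (ofEuc v))))

/-- The entries of `fieldEuc` are explicit quadratic polynomials in the coordinates.
[cite: Hamilton1986, §6, p. 166] -/
theorem fieldEuc_apply (v : Euc) (q : BIdx) :
    fieldEuc v q = blk (reflectB (field (reflectB (ofEuc v)))) q.1 q.2.1 q.2.2 := by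
  simp [fieldEuc]

/-- **Hamilton's field is smooth** (a polynomial map) in the Euclidean model. [folklore] -/
theorem contDiff_fieldEuc : ContDiff ℝ ⊤ fieldEuc := by
  have hc : ∀ q : BIdx, ContDiff ℝ ⊤ fun v : Euc ↦ v q := fun q ↦
    (((EuclideanSpace.proj q : Euc →L[ℝ] ℝ)).contDiff)
  have hpi : ContDiff ℝ ⊤ fun v : Euc ↦ fun q : BIdx ↦
      blk (reflectB (field (reflectB (ofEuc v)))) q.1 q.2.1 q.2.2 := by
    rw [contDiff_pi]
    rintro ⟨k, i, j⟩
    fin_cases k <;> fin_cases i <;> fin_cases j <;>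
      simp [blk, reflectB_field_reflectB, Matrix.mul_apply, Fin.sum_univ_three, Matrix.sharp,
        Matrix.adjugate_fin_three] <;>
      fun_prop
  have : fieldEuc = (fun w ↦ (EuclideanSpace.equiv BIdx ℝ).symm w) ∘ fun v : Euc ↦ fun q : BIdx ↦
      blk (reflectB (field (reflectB (ofEuc v)))) q.1 q.2.1 q.2.2 := by
    funext v; ext q; simp [fieldEuc]
  rw [this]
  exact (EuclideanSpace.equiv BIdx ℝ).symm.contDiff.comp hpi

/-- `fieldEuc` is the model of the conjugated field: `ofEuc (fieldEuc v) = reflectB (field (reflectB (ofEuc v)))`.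
[folklore] -/
@[simp] theorem ofEuc_fieldEuc (v : Euc) :
    ofEuc (fieldEuc v) = reflectB (field (reflectB (ofEuc v))) := by
  simp [fieldEuc]

/-- **Transport of solutions**: a curve in the model solving `β' = fieldEuc β` on a set `S` (with
two-sided derivatives) is, read as block triples, a solution of the conjugated Hamilton system in
the entrywise sense of `HamiltonODE.IsSolutionOn`. [folklore] -/
theorem isSolutionOn_ofEuc {β : ℝ → Euc} {S : Set ℝ}
    (h : ∀ s ∈ S, _root_.HasDerivAt β (fieldEuc (β s)) s) :
    IsSolutionOn (fun p ↦ reflectB (field (reflectB p))) (fun s ↦ ofEuc (β s)) S := by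
  intro s hs
  have := hasDerivAt_ofEuc (h s hs)
  simpa using this

/-- **Transport of invariance.** If `Z` is forward invariant under Hamilton's field and symmetric
under `B ↦ −B`, then its model `toEuc '' Z t` is forward invariant under `fieldEuc` for curves with
two-sided derivatives on `[t₀, t₁]`, `0 ≤ t₀`. [cite: Hamilton1986, §4, Lemma 4.1] -/
theorem mem_image_of_isInvariant {Z : ℝ → Set Blocks} (hinv : IsInvariant field Z)
    (hrefl : ∀ t, ∀ p ∈ Z t, reflectB p ∈ Z t) {β : ℝ → Euc} {t₀ t₁ : ℝ} (h₀ : 0 ≤ t₀)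
    (h₁ : t₀ ≤ t₁) (hβ : ∀ s ∈ Icc t₀ t₁, _root_.HasDerivAt β (fieldEuc (β s)) s)
    (hin : β t₀ ∈ toEuc '' Z t₀) : β t₁ ∈ toEuc '' Z t₁ := by
  have hinv' : IsInvariant (fun p ↦ reflectB (field (reflectB p))) Z :=
    IsInvariantRel.reflect hinv (fun _ _ h ↦ h) hrefl
  have hsol := isSolutionOn_ofEuc hβ
  have hin' : ofEuc (β t₀) ∈ Z t₀ := by
    obtain ⟨p, hp, hpe⟩ := hin
    rw [← hpe, ofEuc_toEuc]; exact hp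
  have hmem := isInvariant_iff.1 hinv' _ t₀ t₁ h₀ h₁ hsol hin'
  exact ⟨ofEuc (β t₁), hmem, toEuc_ofEuc _⟩

end Euclidean

end HamiltonMP

end Literature.Geometry.Riemannian

end
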